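import Summits.AtomisticToContinuum.Crystallization.Theses.GappedShellCensus
import Summits.AtomisticToContinuum.Crystallization.Theses.PalmUnimodularRigidity
import Summits.AtomisticToContinuum.Crystallization.Theorems.PalmUnimodularRigidityCruxesToPalmRigidity
import Summits.AtomisticToContinuum.Crystallization.Theorems.PalmUnimodularRigidityShellsToBarlowChart
import Summits.AtomisticToContinuum.Crystallization.Theorems.PalmUnimodularRigidityLayeredLawsSelectHcpDefs
import Summits.AtomisticToContinuum.Crystallization.Theorems.SquareWellLayerCakeTwelveWithinOne
import Summits.AtomisticToContinuum.Crystallization.Theorems.SquareWellLayerCakeTwelveWithinOneBsLimitAlong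
import Summits.AtomisticToContinuum.Crystallization.Theorems.SquareWellLayerCakeTwelveWithinOneHcpCellCertificate
import Summits.AtomisticToContinuum.Crystallization.Theorems.GappedShellCensusRadialDefectsVanishHcpRootRadial
import Summits.AtomisticToContinuum.Crystallization.Theorems.GappedShellCensusRadialDefectsVanishReturnRadial

/-!
# Crux `GappedShellCensus.RadialDefectsVanish` (stmt-AtomisticToContinuum-15930), line `palm-pinned-scale`:
# the composition — the crux from the two shared hub cruxes `MinimiserShells` (9225) and
# `LayeredLawsSelectHcp` (9226), sorry-free and CONDITIONAL on them

Line `palm-pinned-scale` (crux-strategist s1, 2026-08-17; lead c1 landing): pin the scale in advance,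
`a₀ := 50/51 ∈ [47/50, 1]` (window `[0.98a₀, 1.02a₀] = [49/51, 1]`, gap up to `1.26a₀ = 21/17`),
pass to the Benjamini–Schramm limit law of the ground states (`stub_bsLimitAlong`, landed), and read
the radial census off the hub chain of route `PalmUnimodularRigidity` BY NAME:
`MinimiserShells → ShellsToBarlowChart (landed) → LayeredLawsSelectHcp → PalmRigidity`
(`cruxesToPalmRigidity_proof`, landed): almost surely the rooted sample of a minimising
point-stationary hard-core law is a rotated relaxed hcp crystal `count|A(hcpStacking a h)` with
`e(hcp a h) = e*`.  Pinning is free (`hcpE_globalMin_of_energy_eq_eStar` + the landed two-variable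
certificate `stub_hcpCellCertificate`: both bond lengths in `[55/57 + σ₀, 1 − σ₀] ⊂ (49/51, 1]`),
the root geometry is `stub_hcpRootRadial` (landed, `…HcpRootRadial.lean`) and the portmanteau return
to all but `o(N)` particles is `stub_returnRadial` (landed, `…ReturnRadial.lean`).

This file is the registered composition `RadialDefectsVanish_of_palmCruxes :
MinimiserShells → LayeredLawsSelectHcp → RadialDefectsVanish` in def-free form (the skeleton's
abbreviations `RootGappedTwelve` / `MinimisingLawsGappedTwelve` / `IsRadialGood` are written out).
It credits the crux nothing until items 9225 ∧ 9226 land; the day they do,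
`RadialDefectsVanish_of_palmCruxes MinimiserShells_holds LayeredLawsSelectHcp_holds` closes it.
The radial fallback (stacking-blind torus core) is the landed transfer of line `Sketch`,
`radialDefectsVanish_of_torusRigidity` (`…OfTorusRigidity.lean`).
-/

noncomputable section

open MeasureTheory Filter Set
open scoped ENNReal Topology

namespace Summit.AtomisticToContinuum.Crystallization.Theorems.RadialDefectsVanishPalmPinnedScale

open Literature.MathematicalPhysics.StatisticalMechanics
open Summit.AtomisticToContinuum.Crystallization.Theses.PalmUnimodularRigidity
  (MinimiserShells LayeredLawsSelectHcp PalmRigidity ShellsToBarlowChart)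
open Summit.AtomisticToContinuum.Crystallization.Theorems.PalmUnimodularRigidity.LayeredLawsSelectHcp (hcpE)
open Summit.AtomisticToContinuum.Crystallization.Theorems.SquareWellLayerCakeTwelveWithinOne
  (stub_bsLimitAlong stub_hcpCellCertificate)

/-- **`PalmRigidity` from the two hub cruxes** and the landed chart + glue (`ShellsToBarlowChart_of`,
item 9227; `cruxesToPalmRigidity_proof`, item 9228). [folklore] -/
theorem palmRigidity_of_hubCruxes (hShells : MinimiserShells) (hSelect : LayeredLawsSelectHcp) :
    PalmRigidity :=
  Summit.AtomisticToContinuum.Crystallization.Theorems.PalmUnimodularRigidity.cruxesToPalmRigidity_proof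
    hShells
    Summit.AtomisticToContinuum.Crystallization.Cruxes.ShellsToBarlowChart.DevelopTheModelGrowthDescent.ShellsToBarlowChart_of
    hSelect

/-- **Measure-level gapped-twelve with slack, from the hub cruxes.**  Under `MinimiserShells` and
`LayeredLawsSelectHcp`: if `σ₀ > 0` certifies that every global minimiser `(a, h)` of the hcp lattice
sum `hcpE` has both bond lengths `a`, `√(a²/3 + h²)` in `[55/57 + σ₀, 1 − σ₀]`, then every
minimising point-stationary hard-core law on rooted configurations of `ℝ³` satisfies almost surely,
with `σ = min σ₀ (1/100)`: all atoms pairwise `(55/57 + σ)`-separated, every atom `w ≠ 0` of norm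
`≤ 1 − σ` or `≥ 21/17 + σ`, and exactly twelve atoms `w ≠ 0` of norm `≤ 1 − σ`
(`PalmRigidity` ⇒ a.s. rotated `hcp(a, h)` with `e = e*`; pinning by
`hcpE_globalMin_of_energy_eq_eStar`; root geometry by `stub_hcpRootRadial`). [folklore] -/
theorem minimisingLaws_rootGappedTwelve_of_hubCruxes (hShells : MinimiserShells)
    (hSelect : LayeredLawsSelectHcp) {σ₀ : ℝ} (hσ₀ : 0 < σ₀)
    (hCert : ∀ a h : ℝ, 0 < a → 0 < h →
      (∀ a' h' : ℝ, 0 < a' → 0 < h' → hcpE a h ≤ hcpE a' h') →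
      55 / 57 + σ₀ ≤ a ∧ a ≤ 1 - σ₀ ∧
        55 / 57 + σ₀ ≤ Real.sqrt (a ^ 2 / 3 + h ^ 2) ∧ Real.sqrt (a ^ 2 / 3 + h ^ 2) ≤ 1 - σ₀) :
    ∀ δ : ℝ, 0 < δ → ∀ P : Measure (Measure (EuclideanSpace ℝ (Fin 3))), IsProbabilityMeasure P →
      (∀ᵐ μ ∂P, (∃ S : Set (EuclideanSpace ℝ (Fin 3)), (0 : EuclideanSpace ℝ (Fin 3)) ∈ S ∧
        (∀ x ∈ S, ∀ y ∈ S, x ≠ y → δ ≤ dist x y) ∧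
        μ = (Measure.count : Measure (EuclideanSpace ℝ (Fin 3))).restrict S)) →
      (∀ g : Measure (EuclideanSpace ℝ (Fin 3)) → EuclideanSpace ℝ (Fin 3) → ℝ≥0∞,
        Measurable (Function.uncurry g) →
        ∫⁻ μ, ∫⁻ y, g μ y ∂μ ∂P = ∫⁻ μ, ∫⁻ y, g (Measure.map (fun z => z - y) μ) (-y) ∂μ ∂P) →
      (∫ μ, (∫ y, lennardJones ‖y‖ ∂μ) / 2 ∂P) ≤
        (⨅ Q : PeriodicConfiguration 3, Q.energyPerParticle lennardJones) →
      ∀ᵐ μ ∂P,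
        (∀ w w' : EuclideanSpace ℝ (Fin 3), μ {w} ≠ 0 → μ {w'} ≠ 0 → w ≠ w' →
            55 / 57 + min σ₀ (1 / 100) ≤ dist w w') ∧
          (∀ w : EuclideanSpace ℝ (Fin 3), μ {w} ≠ 0 → w ≠ 0 →
            (‖w‖ ≤ 1 - min σ₀ (1 / 100) ∨ 21 / 17 + min σ₀ (1 / 100) ≤ ‖w‖)) ∧
          ∃ T : Finset (EuclideanSpace ℝ (Fin 3)), T.card = 12 ∧
            (∀ w ∈ T, μ {w} ≠ 0 ∧ w ≠ 0 ∧ ‖w‖ ≤ 1 - min σ₀ (1 / 100)) ∧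
            ∀ w : EuclideanSpace ℝ (Fin 3), μ {w} ≠ 0 → w ≠ 0 →
              ‖w‖ ≤ 1 - min σ₀ (1 / 100) → w ∈ T := by
  intro δ hδ P hP hcore hstat hmin
  have hPalm : PalmRigidity := palmRigidity_of_hubCruxes hShells hSelect
  have hae := hPalm δ hδ P hP hcore hstat hmin
  filter_upwards [hae] with μ hμ
  obtain ⟨a, h, ha, hh, ha1, -, hh1, -, A, hE, rfl⟩ := hμ
  have hapos : 0 < a := by linarith
  have hhpos : 0 < h := by linarith
  obtain ⟨hb1, hb2, hb3, hb4⟩ := hCert a h hapos hhpos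
    (Summit.AtomisticToContinuum.Crystallization.Theorems.SquareWellLayerCakeTwelveWithinOne.Closing.hcpE_globalMin_of_energy_eq_eStar
      ha hh hE)
  have hσpos : 0 < min σ₀ (1 / 100) := lt_min hσ₀ (by norm_num)
  have hσle : min σ₀ (1 / 100) ≤ 1 / 100 := min_le_right _ _
  have hσle' : min σ₀ (1 / 100) ≤ σ₀ := min_le_left _ _
  exact stub_hcpRootRadial (min σ₀ (1 / 100)) a h hσpos hσle (by linarith) (by linarith)
    (by linarith) (by linarith) hhpos A

/-- **Radial defects vanish AT THE PINNED SCALE `50/51`, as a `Tendsto`, from the two hub cruxes**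
(stronger than the crux's `∃ᶠ`): for every sequence of Lennard-Jones ground states the fraction of
particles that are not gapped-twelve at scale `50/51` (the crux's inline clause with `a := 50/51`)
tends to `0` (`stub_hcpCellCertificate` supplies `σ₀`; `minimisingLaws_rootGappedTwelve_of_hubCruxes`;
`stub_returnRadial` with the landed BS limits `stub_bsLimitAlong`). [folklore] -/
theorem tendsto_radialBad_of_hubCruxes (hShells : MinimiserShells) (hSelect : LayeredLawsSelectHcp) :
    ∀ x : (N : ℕ) → (Fin N → EuclideanSpace ℝ (Fin 3)), (∀ N, IsGroundState lennardJones (x N)) →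
      Filter.Tendsto (fun N : ℕ => (Nat.card {i : Fin N // ¬ (
        (Finset.univ.filter fun j : Fin N =>
            j ≠ i ∧ dist (x N i) (x N j) ≤ 50 / 51 * (1 + 1 / 50)).card = 12 ∧
          ∀ j : Fin N, j ≠ i → 50 / 51 * (1 - 1 / 50) ≤ dist (x N i) (x N j) ∧
            (dist (x N i) (x N j) ≤ 50 / 51 * (1 + 1 / 50) ∨
              50 / 51 * (63 / 50) ≤ dist (x N i) (x N j)))} : ℝ) / N)
        Filter.atTop (nhds 0) := by
  obtain ⟨σ₀, hσ₀, hCert⟩ := stub_hcpCellCertificate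
  have hLaws := minimisingLaws_rootGappedTwelve_of_hubCruxes hShells hSelect hσ₀ hCert
  exact stub_returnRadial (min σ₀ (1 / 100)) (lt_min hσ₀ (by norm_num)) hLaws stub_bsLimitAlong

/-- **THE CRUX FROM THE TWO SHARED HUB CRUXES (sorry-free, CONDITIONAL; registered composition of
line `palm-pinned-scale`)**: `MinimiserShells → LayeredLawsSelectHcp →
GappedShellCensus.RadialDefectsVanish` (items stmt-AtomisticToContinuum-9225 and -9226 of route
`PalmUnimodularRigidity`, the only open inputs), at the pinned scale `a := 50/51 ∈ [47/50, 1]`: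
`Tendsto … (nhds 0)` gives, for every `θ > 0`, eventually `#bad ≤ θ·N`, a fortiori frequently. -/
theorem RadialDefectsVanish_of_palmCruxes (hShells : MinimiserShells) (hSelect : LayeredLawsSelectHcp) :
    Summit.AtomisticToContinuum.Crystallization.Theses.GappedShellCensus.RadialDefectsVanish := by
  intro x hx
  refine ⟨50 / 51, by norm_num, by norm_num, fun θ hθ => ?_⟩
  have hT := tendsto_radialBad_of_hubCruxes hShells hSelect x hx
  rw [Metric.tendsto_nhds] at hT
  have hev := (hT θ hθ).and (Filter.eventually_gt_atTop 0)
  refine (hev.mono fun N hN => ?_).frequently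
  obtain ⟨hdist, hN0⟩ := hN
  have hNpos : (0 : ℝ) < N := by exact_mod_cast hN0
  rw [Real.dist_0_eq_abs, abs_of_nonneg (by positivity), div_lt_iff₀ hNpos] at hdist
  exact hdist.le

end Summit.AtomisticToContinuum.Crystallization.Theorems.RadialDefectsVanishPalmPinnedScale

end
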